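import Literature.Analysis.OperatorTheory.PseudoResolvent
import Mathlib.Analysis.InnerProductSpace.Adjoint
import HarnessLib

/-!
# Pseudo-resolvents: the finite Neumann expansion with EXACT remainder (Kato I-§5.2), its norm form, and the
# adjoint-chain form of the Taylor model of `w ↦ ⟪h, J(w) f⟫`

Analysis/OperatorTheory support file (no definition, no named fact; everything proved). For a pseudo-resolvent
`J` on `U ⊂ ℂ` in the sense of `Literature.Analysis.OperatorTheory.IsPseudoResolvent` (first resolvent identity
`J(z) − J(w) = (w − z)J(z)J(w)`, Kato VIII-§1.1 (1.2)) and ANY two points `z, w ∈ U`, iterating the identity gives the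
partial sums of Kato's first Neumann series I-(5.6) with an exact remainder that carries `J(w)` itself:

  `J(w) = Σ_{j<p} (z − w)^j J(z)^{j+1} + (z − w)^p J(z)^p J(w)`      (`eq_sum_add_pow_smul`, all `p : ℕ`),

hence `‖J(w) − Σ_{j<p} (z − w)^j J(z)^{j+1}‖ ≤ |z − w|^p ‖J(z)^p‖ ‖J(w)‖` (`norm_sub_sum_le`) — NO smallness of `|z − w|`
is needed (the remainder is controlled by an a priori bound on `‖J(w)‖`, e.g. a coercivity / numerical-range bound,
instead of by convergence of the series). For operators on a Hilbert space the scalar function `k(w) = ⟪h, J(w)f⟫`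
therefore has the Taylor model

  `⟪h, J(w)f⟫ = Σ_{j<p} (z − w)^j ⟪h, J(z)^{j+1}f⟫ + (z − w)^p ⟪(J(z)†)^p h, J(w)f⟫`      (`inner_apply_eq_sum_add`),

with remainder `≤ |z − w|^p · ‖(J(z)†)^p h‖ · ‖J(w)f‖` (`norm_inner_apply_sub_sum_le`; with an a priori bound
`‖J(w)g‖ ≤ ‖g‖/c`: `…_of_bound`), and the coefficients may be evaluated by forward/adjoint splitting `⟪h, T^{a+b}g⟫ = ⟪(T†)^a h, T^b g⟫`
(`pow_add` + Mathlib's `star_pow` / `adjoint_inner_left`), halving the number of linear solves.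

MOTIVATION (cell ns-blowup, zone Z3, case Z3-SR-SPEC, paper item (P7)): the Evans-function contour certificate steps along
its contour with exactly this Taylor model (`J = (A_F + σJ)⁻¹J` on `{Re σ > −m}`, a pseudo-resolvent by the tree's
`SheetRResolventIdentity` / `SheetRPerturbedResolvent…`, a priori bound `‖J(w)g‖ ≤ ‖g‖/(m + Re w)`); this file is the
abstract kernel form of its remainder `θ|ε|^p‖y_p‖‖h‖/c(σ+ε)`. WHAT THIS IS NOT: not Navier–Stokes; not the far-field
(`|w| → ∞`) expansion of a resolvent, which involves the underlying unbounded operator.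
-/

namespace Literature.Analysis.OperatorTheory
namespace IsPseudoResolvent

open scoped ComplexConjugate InnerProductSpace

/-! ### The finite expansion with exact remainder (pure algebra) -/

section Algebra

variable {A : Type*} [Ring A] [Algebra ℂ A]
variable {U : Set ℂ} {J : ℂ → A}

/-- The resolvent identity solved for `J(w)`: `J(w) = J(z) + (z − w)J(z)J(w)`.
[cite: Kato1966, I-§5.2 (5.5)] -/
theorem eq_add_smul_mul (h : IsPseudoResolvent U J) {z w : ℂ} (hz : z ∈ U) (hw : w ∈ U) :
    J w = J z + (z - w) • (J z * J w) := by
  have h1 := h hz hw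
  rw [show z - w = -(w - z) from (neg_sub w z).symm, neg_smul, ← h1]
  abel

/-- **Finite Neumann expansion with exact remainder** (partial sums of Kato's first Neumann series I-(5.6)): for ANY
`z, w ∈ U` and `p : ℕ`, `J(w) = Σ_{j<p} (z − w)^j J(z)^{j+1} + (z − w)^p J(z)^p J(w)`. No smallness of `|z − w|`.
[cite: Kato1966, I-§5.2 (5.6)] -/
theorem eq_sum_add_pow_smul (h : IsPseudoResolvent U J) {z w : ℂ} (hz : z ∈ U) (hw : w ∈ U) (p : ℕ) :
    J w = (∑ j ∈ Finset.range p, (z - w) ^ j • J z ^ (j + 1)) + (z - w) ^ p • (J z ^ p * J w) := by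
  induction p with
  | zero => simp
  | succ p ih =>
    have hstep : J z ^ p * J w = J z ^ (p + 1) + (z - w) • (J z ^ (p + 1) * J w) := by
      conv_lhs => rw [h.eq_add_smul_mul hz hw]
      rw [mul_add, mul_smul_comm, ← mul_assoc, ← pow_succ]
    conv_lhs => rw [ih, hstep]
    rw [smul_add, smul_smul, ← pow_succ, Finset.sum_range_succ, add_assoc]

end Algebra

/-! ### Norm form -/

section Normed

variable {A : Type*} [NormedRing A] [NormedAlgebra ℂ A]
variable {U : Set ℂ} {J : ℂ → A}

/-- **Remainder estimate**: `‖J(w) − Σ_{j<p} (z − w)^j J(z)^{j+1}‖ ≤ |z − w|^p ‖J(z)^p‖ ‖J(w)‖` for any `z, w ∈ U` — the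
remainder of the Taylor model is controlled by an a priori bound on `‖J(w)‖`, not by convergence of the series.
[cite: Kato1966, I-§5.2 (5.6)] -/
theorem norm_sub_sum_le (h : IsPseudoResolvent U J) {z w : ℂ} (hz : z ∈ U) (hw : w ∈ U) (p : ℕ) :
    ‖J w - ∑ j ∈ Finset.range p, (z - w) ^ j • J z ^ (j + 1)‖ ≤ ‖z - w‖ ^ p * ‖J z ^ p‖ * ‖J w‖ := by
  have h1 : J w - ∑ j ∈ Finset.range p, (z - w) ^ j • J z ^ (j + 1) = (z - w) ^ p • (J z ^ p * J w) := by
    conv_lhs => rw [h.eq_sum_add_pow_smul hz hw p]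
    abel
  rw [h1, norm_smul, norm_pow, mul_assoc]
  exact mul_le_mul_of_nonneg_left (norm_mul_le _ _) (by positivity)

end Normed

/-! ### Operators on a Hilbert space: the adjoint-chain form -/

section Hilbert

variable {E : Type*} [NormedAddCommGroup E] [InnerProductSpace ℂ E] [CompleteSpace E]
variable {U : Set ℂ} {J : ℂ → E →L[ℂ] E}

/-- Adjoint of a power: `(T^n)† = (T†)^n` (Mathlib's `star_pow` read through `star_eq_adjoint`). [folklore] -/
private theorem adjoint_pow (T : E →L[ℂ] E) (n : ℕ) :
    ContinuousLinearMap.adjoint (T ^ n) = (ContinuousLinearMap.adjoint T) ^ n := by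
  rw [← ContinuousLinearMap.star_eq_adjoint, ← ContinuousLinearMap.star_eq_adjoint, star_pow]

/-- Adjoint chain: `⟪h, T^n g⟫ = ⟪(T†)^n h, g⟫`. [folklore] -/
private theorem inner_pow_apply (T : E →L[ℂ] E) (n : ℕ) (h g : E) :
    ⟪h, (T ^ n) g⟫_ℂ = ⟪((ContinuousLinearMap.adjoint T) ^ n) h, g⟫_ℂ := by
  rw [← adjoint_pow, ContinuousLinearMap.adjoint_inner_left]

omit [CompleteSpace E] in
/-- The expansion applied to a vector: `J(w)f = Σ_{j<p} (z − w)^j J(z)^{j+1}f + (z − w)^p J(z)^p(J(w)f)`.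
[cite: Kato1966, I-§5.2 (5.6)] -/
theorem apply_eq_sum_add (hJ : IsPseudoResolvent U J) {z w : ℂ} (hz : z ∈ U) (hw : w ∈ U) (p : ℕ) (f : E) :
    J w f = (∑ j ∈ Finset.range p, (z - w) ^ j • (J z ^ (j + 1)) f) + (z - w) ^ p • (J z ^ p) (J w f) := by
  have h1 := congrArg (fun S : E →L[ℂ] E => S f) (hJ.eq_sum_add_pow_smul hz hw p)
  simpa [mul_apply_eq_comp] using h1

/-- **Taylor model of `w ↦ ⟪h, J(w)f⟫` with the adjoint-chain remainder**: for any `z, w ∈ U`, `p : ℕ`,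
`⟪h, J(w)f⟫ = Σ_{j<p} (z − w)^j ⟪h, J(z)^{j+1}f⟫ + (z − w)^p ⟪(J(z)†)^p h, J(w)f⟫`.
[cite: Kato1966, I-§5.2 (5.6)] -/
theorem inner_apply_eq_sum_add (hJ : IsPseudoResolvent U J) {z w : ℂ} (hz : z ∈ U) (hw : w ∈ U) (p : ℕ)
    (h f : E) :
    ⟪h, J w f⟫_ℂ = (∑ j ∈ Finset.range p, (z - w) ^ j * ⟪h, (J z ^ (j + 1)) f⟫_ℂ)
      + (z - w) ^ p * ⟪((ContinuousLinearMap.adjoint (J z)) ^ p) h, J w f⟫_ℂ := by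
  conv_lhs => rw [hJ.apply_eq_sum_add hz hw p f]
  rw [inner_add_right, inner_sum, inner_smul_right, inner_pow_apply]
  simp only [inner_smul_right]

/-- **Remainder bound (Cauchy–Schwarz)**: `‖⟪h, J(w)f⟫ − Σ_{j<p} (z − w)^j⟪h, J(z)^{j+1}f⟫‖ ≤ |z − w|^p·‖(J(z)†)^p h‖·‖J(w)f‖`.
[cite: Kato1966, I-§5.2 (5.6)] -/
theorem norm_inner_apply_sub_sum_le (hJ : IsPseudoResolvent U J) {z w : ℂ} (hz : z ∈ U) (hw : w ∈ U) (p : ℕ)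
    (h f : E) :
    ‖⟪h, J w f⟫_ℂ - ∑ j ∈ Finset.range p, (z - w) ^ j * ⟪h, (J z ^ (j + 1)) f⟫_ℂ‖ ≤
      ‖z - w‖ ^ p * ‖((ContinuousLinearMap.adjoint (J z)) ^ p) h‖ * ‖J w f‖ := by
  rw [hJ.inner_apply_eq_sum_add hz hw p h f, add_sub_cancel_left, norm_mul, norm_pow, mul_assoc]
  exact mul_le_mul_of_nonneg_left (norm_inner_le_norm _ _) (by positivity)

/-- **Remainder bound with an a priori resolvent estimate**: if `‖J(w)g‖ ≤ ‖g‖/c` for all `g` (e.g. a coercivity bound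
`c = m + Re w` of a sectorial pencil), then the order-`p` Taylor model of `⟪h, J(w)f⟫` about `z` has remainder
`≤ |z − w|^p · ‖(J(z)†)^p h‖ · ‖f‖ / c` — the adjoint-chain step-radius rule of an Evans-function contour certificate.
[cite: Kato1966, I-§5.2 (5.6)] -/
theorem norm_inner_apply_sub_sum_le_of_bound (hJ : IsPseudoResolvent U J) {z w : ℂ} (hz : z ∈ U) (hw : w ∈ U)
    (p : ℕ) (h f : E) {c : ℝ} (hb : ∀ g : E, ‖J w g‖ ≤ ‖g‖ / c) :
    ‖⟪h, J w f⟫_ℂ - ∑ j ∈ Finset.range p, (z - w) ^ j * ⟪h, (J z ^ (j + 1)) f⟫_ℂ‖ ≤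
      ‖z - w‖ ^ p * ‖((ContinuousLinearMap.adjoint (J z)) ^ p) h‖ * ‖f‖ / c := by
  refine (hJ.norm_inner_apply_sub_sum_le hz hw p h f).trans ?_
  rw [mul_div_assoc]
  exact mul_le_mul_of_nonneg_left (hb f) (by positivity)

end Hilbert

end IsPseudoResolvent
end Literature.Analysis.OperatorTheory
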